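import Summits.QuantumFields.YangMills.Theorems.FlatTubeReductionKineticLevelSets
import HarnessLib

/-!
# The Faddeev–Popov-weighted Haar volume of a kinetic level set: `∫ fpWeight ε·𝟙{kinDefect U V ≤ D} dg ≤ fpZ ε·((π²/12)(3L(√D + 5a + a′))³)^{|Λ|−1}` and the matching floor
# `≥ fpZ ε·(ρ³/10)^{|Λ|−1}` at level `|E|(2ρ + a + a′)²` — the gauge part of the volume growth / floor of the log-free layer cake, with the FP scale factored out EXACTLY
# (route `FlatTubeReduction`, crux K1 `NearFlatRatioLaw` stmt-QuantumFields-24720; seat `ym-line-ftr-p1` g12; rate twin «ratepack-v3 / frozen fibres»; R2b1 RECORD rung — no summit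
# statement is proved here)

WHY (memo `Cruxes/NearFlatRatioLaw/Lines/ratepack-v3-frozen-g12.md` §5.7, brick (viii-a)).  In colour coordinates `g = colourJoin 0 (c, k)` (`…ColourDisintegration`):
`kinDefect U V (c·k) = kinDefect (c⁻¹Uc) V k` (`kinDefect_constMul`), the amplitudes `‖q(c⁻¹U_ec) − 1‖ = ‖q(U_e) − 1‖` do not see `c`, so the level set of `k` lies in a `c`-INDEPENDENT
box (`kinLevelSet_subset_box`) / contains a `c`-independent box (generic `kinDefect_le_of_box`), and the `c`-integral of the FP window is `fpZ ε` for every `k`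
(`integral_fpWeight_colourJoin`).  Hence, for ANY configurations `U, V` with `‖q(U_e) − 1‖ ≤ a`, `‖q(V_e) − 1‖ ≤ a′`:
* ★★ `integral_fpWeight_kinLevelSet_le` — `∫ fpWeight ε g·𝟙{kinDefect U V g ≤ D} dgaugeMeasure ≤ fpZ ε·((π²/12)(3L(√D + 5a + a′))³)^{|Λ|−1}`;
* ★★ `integral_fpWeight_kinLevelSet_ge` — `fpZ ε·(ρ³/10)^{|Λ|−1} ≤ ∫ fpWeight ε g·𝟙{kinDefect U V g ≤ |E|(2ρ + a + a′)²} dgaugeMeasure` (`0 < ρ ≤ 1`).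
The ratio of the two at `D = t/β`, `ρ = β^{-1/2}`, `a, a′ = O(‖v̂‖ + ‖v̂′‖)` is polynomial in `√t` and in `β^{1/2}(‖v̂‖ + ‖v̂′‖)` — β-free after the profile's Gaussian moments.
HONEST FRAMING: measure bookkeeping; femto rung R2b1 (RECORD label); not infinite volume, not a gap, not Clay.  No defs, no named facts, no `sorry`.
-/

set_option autoImplicit false

noncomputable section

open MeasureTheory Filter Topology Real Set
open scoped BigOperators ENNReal Quaternion
open Literature.MathematicalPhysics.QuantumFieldTheory
open Literature.MathematicalPhysics.QuantumLattice

namespace Summit.QuantumFields.YangMills.Theorems.FemtoTransferGap.RateTube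

open Summit.QuantumFields.YangMills.Theorems.FemtoTransferGap
open Summit.QuantumFields.YangMills.Theorems.FemtoTransferGap.TwoLattice
open Summit.QuantumFields.YangMills.Theorems.FemtoTransferGap.TwoLattice.ConstTube
open Summit.QuantumFields.YangMills.Theorems.FemtoTransferGap.TwoLattice.Avg

variable {L : ℕ} [NeZero L]

/-! ## §1 Pointwise: conjugation does not move amplitudes; a box lies in a level set (generic pair) -/

omit [NeZero L] in
/-- `‖q(c⁻¹Uc) − 1‖ = ‖q(U) − 1‖`. [folklore] -/
theorem norm_su2Quat_conj_sub_one (c U : SU2) : ‖su2Quat (c⁻¹ * U * c) - 1‖ = ‖su2Quat U - 1‖ := by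
  have hcc : su2Quat c⁻¹ * su2Quat c = 1 := by rw [← su2Quat_mul, inv_mul_cancel, su2Quat_one]
  have e : su2Quat (c⁻¹ * U * c) - 1 = su2Quat c⁻¹ * (su2Quat U - 1) * su2Quat c := by
    rw [su2Quat_mul, su2Quat_mul, mul_sub, sub_mul, mul_one, hcc]
  rw [e, norm_mul, norm_mul, norm_su2Quat, norm_su2Quat, one_mul, mul_one]

/-- **Box ⊆ level set, generic pair**: `‖q(U_e) − 1‖ ≤ a`, `‖q(V_e) − 1‖ ≤ a′`, `g ∈ G_c(ρ)` ⇒ `kinDefect U V g ≤ |E|·(2ρ + a + a′)²`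
(`Δ_e = q(U)(q(g_y) − 1) − (q(g_x) − 1)q(V) + (q(U) − 1) − (q(V) − 1)`). [folklore] -/
theorem kinDefect_le_of_gaugeCore (U V : GaugeConfig 3 L SU2) {a a' : ℝ} (ha : ∀ e, ‖su2Quat (U e) - 1‖ ≤ a) (ha' : ∀ e, ‖su2Quat (V e) - 1‖ ≤ a')
    {ρ : ℝ} {g : Site 3 L → SU2} (hg : g ∈ gaugeCore L ρ) :
    kinDefect L U V g ≤ (Fintype.card (Edge 3 L) : ℝ) * (2 * ρ + a + a') ^ 2 := by
  have hρ0 : 0 ≤ ρ := (norm_nonneg _).trans (hg 0)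
  have ha0 : 0 ≤ a := (norm_nonneg _).trans (ha default)
  have ha0' : 0 ≤ a' := (norm_nonneg _).trans (ha' default)
  have he : ∀ e : Edge 3 L, ‖su2Quat (U e) * su2Quat (g (e.1.shift e.2)) - su2Quat (g e.1) * su2Quat (V e)‖ ≤ 2 * ρ + a + a' := fun e => by
    have eq : su2Quat (U e) * su2Quat (g (e.1.shift e.2)) - su2Quat (g e.1) * su2Quat (V e) =
        su2Quat (U e) * (su2Quat (g (e.1.shift e.2)) - 1) - (su2Quat (g e.1) - 1) * su2Quat (V e) + ((su2Quat (U e) - 1) - (su2Quat (V e) - 1)) := by noncomm_ring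
    rw [eq]
    have h1 : ‖su2Quat (U e) * (su2Quat (g (e.1.shift e.2)) - 1)‖ ≤ ρ := by rw [norm_mul, norm_su2Quat, one_mul]; exact hg _
    have h2 : ‖(su2Quat (g e.1) - 1) * su2Quat (V e)‖ ≤ ρ := by rw [norm_mul, norm_su2Quat, mul_one]; exact hg _
    have h3 : ‖(su2Quat (U e) - 1) - (su2Quat (V e) - 1)‖ ≤ a + a' := (norm_sub_le _ _).trans (add_le_add (ha e) (ha' e))
    have t1 := norm_add_le (su2Quat (U e) * (su2Quat (g (e.1.shift e.2)) - 1) - (su2Quat (g e.1) - 1) * su2Quat (V e)) ((su2Quat (U e) - 1) - (su2Quat (V e) - 1))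
    have t2 := norm_sub_le (su2Quat (U e) * (su2Quat (g (e.1.shift e.2)) - 1)) ((su2Quat (g e.1) - 1) * su2Quat (V e))
    linarith
  unfold kinDefect
  calc ∑ e : Edge 3 L, ‖su2Quat (U e) * su2Quat (g (e.1.shift e.2)) - su2Quat (g e.1) * su2Quat (V e)‖ ^ 2 ≤ ∑ _e : Edge 3 L, (2 * ρ + a + a') ^ 2 :=
        Finset.sum_le_sum fun e _ => pow_le_pow_left₀ (norm_nonneg _) (he e) 2
    _ = (Fintype.card (Edge 3 L) : ℝ) * (2 * ρ + a + a') ^ 2 := by rw [Finset.sum_const, Finset.card_univ, nsmul_eq_mul]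

/-- The kinetic defect is continuous in the gauge field. [folklore] -/
theorem continuous_kinDefect_gauge (U V : GaugeConfig 3 L SU2) : Continuous fun g : Site 3 L → SU2 => kinDefect L U V g := by
  have hq := Literature.MathematicalPhysics.QuantumFieldTheory.Balaban1983to89.T4HaarSU2Translate.continuous_su2Quat
  unfold kinDefect
  refine continuous_finsetSum _ fun e _ => ?_
  have h1 : Continuous fun g : Site 3 L → SU2 => su2Quat (g (e.1.shift e.2)) := hq.comp (continuous_apply (e.1.shift e.2))
  have h2 : Continuous fun g : Site 3 L → SU2 => su2Quat (g e.1) := hq.comp (continuous_apply e.1)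
  exact ((continuous_const.mul h1).sub (h2.mul continuous_const)).norm.pow 2

/-! ## §2 ★★ The FP-weighted volume of a level set, from above -/

set_option maxHeartbeats 800000 in
/-- ★★ **FP-weighted volume growth**: `∫ fpWeight ε g·𝟙{kinDefect U V g ≤ D} dgaugeMeasure ≤ fpZ ε·((π²/12)(3L(√D + 5a + a′))³)^{|Λ|−1}` whenever `‖q(U_e) − 1‖ ≤ a`,
`‖q(V_e) − 1‖ ≤ a′`. [cite: Luscher1983, §3] -/
theorem integral_fpWeight_kinLevelSet_le (ε : ℝ) (U V : GaugeConfig 3 L SU2) {a a' : ℝ} (ha : ∀ e, ‖su2Quat (U e) - 1‖ ≤ a) (ha' : ∀ e, ‖su2Quat (V e) - 1‖ ≤ a')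
    (D : ℝ) :
    ∫ g, fpWeight L ε g * Set.indicator {g | kinDefect L U V g ≤ D} (fun _ => (1 : ℝ)) g ∂gaugeMeasure L ≤
      fpZ ε * (π ^ 2 / 12 * (3 * L * (Real.sqrt D + 5 * a + a')) ^ 3) ^ Fintype.card {x : Site 3 L // ¬x = 0} := by
  haveI : SecondCountableTopology SU2 := secondCountableTopology_su2
  have ha0 : 0 ≤ a := (norm_nonneg _).trans (ha default)
  have ha0' : 0 ≤ a' := (norm_nonneg _).trans (ha' default)
  set R : ℝ := 3 * L * (Real.sqrt D + 5 * a + a') with hR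
  set box : Set ({x : Site 3 L // ¬x = 0} → SU2) := Set.pi Set.univ fun _ => quatBall R with hbox
  have hboxm : MeasurableSet box := MeasurableSet.univ_pi fun _ => measurableSet_quatBall R
  have hSm : MeasurableSet {g : Site 3 L → SU2 | kinDefect L U V g ≤ D} := measurableSet_le (continuous_kinDefect_gauge U V).measurable measurable_const
  -- the integrand and its disintegration
  set Φ : (Site 3 L → SU2) → ℝ := fun g => fpWeight L ε g * Set.indicator {g | kinDefect L U V g ≤ D} (fun _ => (1 : ℝ)) g with hΦ
  have hΦm : Measurable Φ := (measurable_fpWeight L ε).mul (measurable_const.indicator hSm)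
  have hΦb : ∀ g, |Φ g| ≤ 1 := fun g => by
    rw [hΦ]; dsimp only
    have h1 := fpWeight_mem_Icc L ε g
    have h2 : 0 ≤ Set.indicator {g | kinDefect L U V g ≤ D} (fun _ => (1 : ℝ)) g ∧ Set.indicator {g | kinDefect L U V g ≤ D} (fun _ => (1 : ℝ)) g ≤ 1 :=
      ⟨Set.indicator_nonneg (fun _ _ => zero_le_one) _, Set.indicator_le_self' (fun _ _ => zero_le_one) _⟩
    rw [abs_of_nonneg (mul_nonneg h1.1 h2.1)]
    calc fpWeight L ε g * _ ≤ 1 * 1 := mul_le_mul h1.2 h2.2 h2.1 zero_le_one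
      _ = 1 := one_mul _
  have hΦi : Integrable Φ (gaugeMeasure L) := integrable_of_measurable_abs_le _ hΦm hΦb
  rw [show (∫ g, fpWeight L ε g * Set.indicator {g | kinDefect L U V g ≤ D} (fun _ => (1 : ℝ)) g ∂gaugeMeasure L) = ∫ g, Φ g ∂gaugeMeasure L from rfl,
    integral_gaugeMeasure_eq_colour 0 hΦi]
  -- pointwise: Φ(colourJoin 0 (c,k)) ≤ fpWeight(colourJoin 0 (c,k)) · 𝟙_box(k)
  have hpt : ∀ (c : SU2) (k : {x : Site 3 L // ¬x = 0} → SU2), Φ (colourJoin 0 (c, k)) ≤ fpWeight L ε (colourJoin 0 (c, k)) * box.indicator (fun _ => (1 : ℝ)) k := by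
    intro c k
    rw [hΦ]; dsimp only
    refine mul_le_mul_of_nonneg_left ?_ (fpWeight_mem_Icc L ε _).1
    by_cases hk : k ∈ box
    · rw [Set.indicator_of_mem hk]; exact Set.indicator_le_self' (fun _ _ => zero_le_one) _
    · rw [Set.indicator_of_notMem hk]
      refine le_of_eq (Set.indicator_of_notMem ?_ _)
      intro hmem
      apply hk
      have hmem' : kinDefect L (fun e => c⁻¹ * U e * c) V (colourJoin 0 (1, k)) ≤ D := by
        have h : kinDefect L U V (colourJoin 0 (c, k)) ≤ D := hmem
        rwa [colourJoin_eq_constMul 0 c k, kinDefect_constMul] at h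
      have hsub := kinLevelSet_subset_box (L := L) (fun e => c⁻¹ * U e * c) V (a := a) (b := a + a') (fun e => by rw [norm_su2Quat_conj_sub_one]; exact ha e)
        (fun e => by
          calc ‖su2Quat (c⁻¹ * U e * c) - su2Quat (V e)‖ ≤ ‖su2Quat (c⁻¹ * U e * c) - 1‖ + ‖(1 : ℍ) - su2Quat (V e)‖ := norm_sub_le_norm_sub_add_norm_sub _ _ _
            _ ≤ a + a' := add_le_add (by rw [norm_su2Quat_conj_sub_one]; exact ha e) (by rw [norm_sub_rev]; exact ha' e)) D hmem'
      have eR : 3 * (L : ℝ) * (Real.sqrt D + 4 * a + (a + a')) = R := by rw [hR]; ring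
      rw [eR] at hsub
      exact hsub
  -- the majorant is integrable on the product and its iterated integral is fpZ · Haar(box)
  set Ψ : SU2 × ({x : Site 3 L // ¬x = 0} → SU2) → ℝ := fun q => fpWeight L ε (colourJoin 0 q) * box.indicator (fun _ => (1 : ℝ)) q.2 with hΨ
  have hΨm : Measurable Ψ := ((measurable_fpWeight L ε).comp (measurable_colourJoin 0)).mul ((measurable_const.indicator hboxm).comp measurable_snd)
  have hΨb : ∀ q, |Ψ q| ≤ 1 := fun q => by
    rw [hΨ]; dsimp only
    have h1 := fpWeight_mem_Icc L ε (colourJoin 0 q)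
    have h2 : 0 ≤ box.indicator (fun _ => (1 : ℝ)) q.2 ∧ box.indicator (fun _ => (1 : ℝ)) q.2 ≤ 1 :=
      ⟨Set.indicator_nonneg (fun _ _ => zero_le_one) _, Set.indicator_le_self' (fun _ _ => zero_le_one) _⟩
    rw [abs_of_nonneg (mul_nonneg h1.1 h2.1)]
    calc fpWeight L ε (colourJoin 0 q) * _ ≤ 1 * 1 := mul_le_mul h1.2 h2.2 h2.1 zero_le_one
      _ = 1 := one_mul _
  have hΨi : Integrable Ψ ((haarProbability SU2).prod (Measure.pi fun _ : {x : Site 3 L // ¬x = 0} => haarProbability SU2)) :=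
    integrable_of_measurable_abs_le _ hΨm hΨb
  have hΦi' : Integrable (fun q : SU2 × ({x : Site 3 L // ¬x = 0} → SU2) => Φ (colourJoin 0 q))
      ((haarProbability SU2).prod (Measure.pi fun _ : {x : Site 3 L // ¬x = 0} => haarProbability SU2)) := integrable_comp_colourJoin 0 hΦi
  have hstep1 : ∫ c, ∫ k, Φ (colourJoin 0 (c, k)) ∂(Measure.pi fun _ : {x : Site 3 L // ¬x = 0} => haarProbability SU2) ∂haarProbability SU2 ≤
      ∫ c, ∫ k, Ψ (c, k) ∂(Measure.pi fun _ : {x : Site 3 L // ¬x = 0} => haarProbability SU2) ∂haarProbability SU2 := by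
    rw [← integral_prod _ hΦi', ← integral_prod _ hΨi]
    exact integral_mono hΦi' hΨi fun q => hpt q.1 q.2
  have hstep2 : ∫ c, ∫ k, Ψ (c, k) ∂(Measure.pi fun _ : {x : Site 3 L // ¬x = 0} => haarProbability SU2) ∂haarProbability SU2 =
      fpZ ε * (haarProbability SU2).real (quatBall R) ^ Fintype.card {x : Site 3 L // ¬x = 0} := by
    rw [integral_integral_swap hΨi]
    have hinner : ∀ k : {x : Site 3 L // ¬x = 0} → SU2, ∫ c, Ψ (c, k) ∂haarProbability SU2 = box.indicator (fun _ => (1 : ℝ)) k * fpZ ε := fun k => by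
      rw [hΨ]; dsimp only
      rw [integral_mul_const, integral_fpWeight_colourJoin, mul_comm]
    rw [integral_congr_ae (ae_of_all _ hinner), integral_mul_const, integral_indicator_const _ hboxm, smul_eq_mul, mul_one, mul_comm, hbox, pi_real_box]
  have hR0 : 0 ≤ R := by rw [hR]; positivity
  have hZ0 : 0 ≤ fpZ ε := by unfold fpZ; exact measureReal_nonneg
  calc ∫ c, ∫ k, Φ (colourJoin 0 (c, k)) ∂(Measure.pi fun _ : {x : Site 3 L // ¬x = 0} => haarProbability SU2) ∂haarProbability SU2
      ≤ fpZ ε * (haarProbability SU2).real (quatBall R) ^ Fintype.card {x : Site 3 L // ¬x = 0} := hstep1.trans (le_of_eq hstep2)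
    _ ≤ fpZ ε * (π ^ 2 / 12 * R ^ 3) ^ Fintype.card {x : Site 3 L // ¬x = 0} :=
        mul_le_mul_of_nonneg_left (pow_le_pow_left₀ measureReal_nonneg (haarReal_quatBall_le hR0) _) hZ0

/-! ## §3 ★★ The FP-weighted volume of a level set, from below -/

set_option maxHeartbeats 800000 in
/-- ★★ **FP-weighted floor**: for `0 < ρ ≤ 1`, `‖q(U_e) − 1‖ ≤ a`, `‖q(V_e) − 1‖ ≤ a′`:
`fpZ ε·(ρ³/10)^{|Λ|−1} ≤ ∫ fpWeight ε g·𝟙{kinDefect U V g ≤ |E|(2ρ + a + a′)²} dgaugeMeasure`. [cite: Luscher1983, §3] -/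
theorem integral_fpWeight_kinLevelSet_ge (ε : ℝ) (U V : GaugeConfig 3 L SU2) {a a' : ℝ} (ha : ∀ e, ‖su2Quat (U e) - 1‖ ≤ a) (ha' : ∀ e, ‖su2Quat (V e) - 1‖ ≤ a')
    {ρ : ℝ} (hρ : 0 < ρ) (hρ1 : ρ ≤ 1) :
    fpZ ε * (ρ ^ 3 / 10) ^ Fintype.card {x : Site 3 L // ¬x = 0} ≤
      ∫ g, fpWeight L ε g * Set.indicator {g | kinDefect L U V g ≤ (Fintype.card (Edge 3 L) : ℝ) * (2 * ρ + a + a') ^ 2} (fun _ => (1 : ℝ)) g ∂gaugeMeasure L := by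
  haveI : SecondCountableTopology SU2 := secondCountableTopology_su2
  set D : ℝ := (Fintype.card (Edge 3 L) : ℝ) * (2 * ρ + a + a') ^ 2 with hD
  set box : Set ({x : Site 3 L // ¬x = 0} → SU2) := Set.pi Set.univ fun _ => quatBall ρ with hbox
  have hboxm : MeasurableSet box := MeasurableSet.univ_pi fun _ => measurableSet_quatBall ρ
  have hSm : MeasurableSet {g : Site 3 L → SU2 | kinDefect L U V g ≤ D} := measurableSet_le (continuous_kinDefect_gauge U V).measurable measurable_const
  set Φ : (Site 3 L → SU2) → ℝ := fun g => fpWeight L ε g * Set.indicator {g | kinDefect L U V g ≤ D} (fun _ => (1 : ℝ)) g with hΦ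
  have hΦm : Measurable Φ := (measurable_fpWeight L ε).mul (measurable_const.indicator hSm)
  have hΦb : ∀ g, |Φ g| ≤ 1 := fun g => by
    rw [hΦ]; dsimp only
    have h1 := fpWeight_mem_Icc L ε g
    have h2 : 0 ≤ Set.indicator {g | kinDefect L U V g ≤ D} (fun _ => (1 : ℝ)) g ∧ Set.indicator {g | kinDefect L U V g ≤ D} (fun _ => (1 : ℝ)) g ≤ 1 :=
      ⟨Set.indicator_nonneg (fun _ _ => zero_le_one) _, Set.indicator_le_self' (fun _ _ => zero_le_one) _⟩
    rw [abs_of_nonneg (mul_nonneg h1.1 h2.1)]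
    calc fpWeight L ε g * _ ≤ 1 * 1 := mul_le_mul h1.2 h2.2 h2.1 zero_le_one
      _ = 1 := one_mul _
  have hΦi : Integrable Φ (gaugeMeasure L) := integrable_of_measurable_abs_le _ hΦm hΦb
  rw [show (∫ g, fpWeight L ε g * Set.indicator {g | kinDefect L U V g ≤ (Fintype.card (Edge 3 L) : ℝ) * (2 * ρ + a + a') ^ 2} (fun _ => (1 : ℝ)) g ∂gaugeMeasure L) =
      ∫ g, Φ g ∂gaugeMeasure L from rfl, integral_gaugeMeasure_eq_colour 0 hΦi]
  -- pointwise: fpWeight(colourJoin 0 (c,k)) · 𝟙_box(k) ≤ Φ(colourJoin 0 (c,k))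
  have hpt : ∀ (c : SU2) (k : {x : Site 3 L // ¬x = 0} → SU2), fpWeight L ε (colourJoin 0 (c, k)) * box.indicator (fun _ => (1 : ℝ)) k ≤ Φ (colourJoin 0 (c, k)) := by
    intro c k
    rw [hΦ]; dsimp only
    refine mul_le_mul_of_nonneg_left ?_ (fpWeight_mem_Icc L ε _).1
    by_cases hk : k ∈ box
    · have hS : colourJoin 0 (c, k) ∈ {g : Site 3 L → SU2 | kinDefect L U V g ≤ D} := by
        show kinDefect L U V (colourJoin 0 (c, k)) ≤ D
        rw [colourJoin_eq_constMul 0 c k, kinDefect_constMul]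
        have hg : colourJoin 0 (1, k) ∈ gaugeCore L ρ := by
          intro x
          by_cases hx : x = 0
          · subst hx; rw [colourJoin_apply_self, su2Quat_one, sub_self, norm_zero]; exact hρ.le
          · have h := hk ⟨x, hx⟩ (Set.mem_univ _)
            rw [colourJoin_apply_ne 0 _ hx, one_mul]; exact h
        exact kinDefect_le_of_gaugeCore (L := L) (fun e => c⁻¹ * U e * c) V (fun e => by rw [norm_su2Quat_conj_sub_one]; exact ha e) ha' hg
      rw [Set.indicator_of_mem hk, Set.indicator_of_mem hS]
    · rw [Set.indicator_of_notMem hk]; exact Set.indicator_nonneg (fun _ _ => zero_le_one) _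
  set Ψ : SU2 × ({x : Site 3 L // ¬x = 0} → SU2) → ℝ := fun q => fpWeight L ε (colourJoin 0 q) * box.indicator (fun _ => (1 : ℝ)) q.2 with hΨ
  have hΨm : Measurable Ψ := ((measurable_fpWeight L ε).comp (measurable_colourJoin 0)).mul ((measurable_const.indicator hboxm).comp measurable_snd)
  have hΨb : ∀ q, |Ψ q| ≤ 1 := fun q => by
    rw [hΨ]; dsimp only
    have h1 := fpWeight_mem_Icc L ε (colourJoin 0 q)
    have h2 : 0 ≤ box.indicator (fun _ => (1 : ℝ)) q.2 ∧ box.indicator (fun _ => (1 : ℝ)) q.2 ≤ 1 :=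
      ⟨Set.indicator_nonneg (fun _ _ => zero_le_one) _, Set.indicator_le_self' (fun _ _ => zero_le_one) _⟩
    rw [abs_of_nonneg (mul_nonneg h1.1 h2.1)]
    calc fpWeight L ε (colourJoin 0 q) * _ ≤ 1 * 1 := mul_le_mul h1.2 h2.2 h2.1 zero_le_one
      _ = 1 := one_mul _
  have hΨi : Integrable Ψ ((haarProbability SU2).prod (Measure.pi fun _ : {x : Site 3 L // ¬x = 0} => haarProbability SU2)) :=
    integrable_of_measurable_abs_le _ hΨm hΨb
  have hΦi' : Integrable (fun q : SU2 × ({x : Site 3 L // ¬x = 0} → SU2) => Φ (colourJoin 0 q))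
      ((haarProbability SU2).prod (Measure.pi fun _ : {x : Site 3 L // ¬x = 0} => haarProbability SU2)) := integrable_comp_colourJoin 0 hΦi
  have hstep1 : ∫ c, ∫ k, Ψ (c, k) ∂(Measure.pi fun _ : {x : Site 3 L // ¬x = 0} => haarProbability SU2) ∂haarProbability SU2 ≤
      ∫ c, ∫ k, Φ (colourJoin 0 (c, k)) ∂(Measure.pi fun _ : {x : Site 3 L // ¬x = 0} => haarProbability SU2) ∂haarProbability SU2 := by
    rw [← integral_prod _ hΦi', ← integral_prod _ hΨi]
    exact integral_mono hΨi hΦi' fun q => hpt q.1 q.2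
  have hstep2 : ∫ c, ∫ k, Ψ (c, k) ∂(Measure.pi fun _ : {x : Site 3 L // ¬x = 0} => haarProbability SU2) ∂haarProbability SU2 =
      fpZ ε * (haarProbability SU2).real (quatBall ρ) ^ Fintype.card {x : Site 3 L // ¬x = 0} := by
    rw [integral_integral_swap hΨi]
    have hinner : ∀ k : {x : Site 3 L // ¬x = 0} → SU2, ∫ c, Ψ (c, k) ∂haarProbability SU2 = box.indicator (fun _ => (1 : ℝ)) k * fpZ ε := fun k => by
      rw [hΨ]; dsimp only
      rw [integral_mul_const, integral_fpWeight_colourJoin, mul_comm]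
    rw [integral_congr_ae (ae_of_all _ hinner), integral_mul_const, integral_indicator_const _ hboxm, smul_eq_mul, mul_one, mul_comm, hbox, pi_real_box]
  have hZ0 : 0 ≤ fpZ ε := by unfold fpZ; exact measureReal_nonneg
  calc fpZ ε * (ρ ^ 3 / 10) ^ Fintype.card {x : Site 3 L // ¬x = 0} ≤ fpZ ε * (haarProbability SU2).real (quatBall ρ) ^ Fintype.card {x : Site 3 L // ¬x = 0} :=
        mul_le_mul_of_nonneg_left (pow_le_pow_left₀ (by positivity) (haarReal_quatBall_ge hρ hρ1) _) hZ0
    _ = ∫ c, ∫ k, Ψ (c, k) ∂(Measure.pi fun _ : {x : Site 3 L // ¬x = 0} => haarProbability SU2) ∂haarProbability SU2 := hstep2.symm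
    _ ≤ _ := hstep1

end Summit.QuantumFields.YangMills.Theorems.FemtoTransferGap.RateTube

end
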